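import Summits.QuantumFields.YangMills.Theorems.UnitScaleTiltProp7HcoWOfSigmaRowsSlots
import HarnessLib

/-!
# Route `UnitScaleTilt`, crux K1 «MinimiserStabilityRegPr» (stmt-QuantumFields-19200) — ARCHITECTURE (A′) «HCOW-VIA-Σ» (★★OWNER RULING g28-№13∕№15), F4″ = THE NAMER’S JOINT ASSEMBLER:
# `hcoW` ⇐ the Σ-rows of ✓`hcoW_of_sigmaRowsW_slots` with the (JOINT-Σ) row booked in P-A2’s binder currency `C₁ℓ⁻¹·M + C₂ℓ·(K + DIV)` plus P-A4’s crude slice row `DIV ≤ ζ·K + δ₁·ℓ⁻²·M`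

Cell `ym3-torus` ∕ fleet seat `ym-ust-19200-p1` (gen 17, route-R E′ lead ∕ namer).  THEOREMS ONLY (0 `def`, 0 `sorry`); `--supports stmt-QuantumFields-19200`, count-neutral.
YM₃ on T³ is a ladder rung (R3), not the Clay problem; nothing here claims the stub, the crux, `hcoW`, HESS at the critical configuration, d = 4 or the mass gap — every row is DISPLAYED.

WHY (namer WORDS 15–16, PLAN (A′) packages P-A2∕P-A4∕P-A5).  The P-A2 binder (routeR-w3 g7 LOCATE bc08ddff §1, files F0″–F3″ by px18∕routeR-w6∕px15∕px22∕routeR-w3) books the chart remainder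
`Σ_c ‖C(W; X) c‖` of a competitor `X = ηA` against `C₁·ℓ⁻¹·Σ_b‖X b‖² + C₂·ℓ·(Σ_p‖ℒ_p X‖² + DIV)`, `DIV` = the covariant-divergence mass of `X` at `W` — second order in the full covariant
derivative, not in the curl alone ([Balaban1985Variational] (47) p.286, (106)–(111) p.294).  On print’s slice `R(W)D*_W X = 0` ([Balaban1985Variational] (138) p.298) the divergence is
a `K`-scale block average and P-A4 (px12 g5; displayed row `bern_P` acceptable, RULING g28-№15) books `DIV ≤ ζ·Σ_p‖ℒ_p X‖² + δ₁·ℓ⁻²·Σ_b‖X b‖²` ([Balaban1985RegularSpaces] (1.38) p.82 class).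
This file is the knit: `(C₁, C₂) ↦ (C₁ + C₂δ₁, C₂(1 + ζ))` turns the pair of rows into the (JOINT-Σ) row of ✓`hcoW_of_sigmaRowsW_slots` VERBATIM, with the windows stated for the knitted
constants, so that the P-A5 end-to-end `example` feeds the binder’s and P-A4’s outputs BY NAME.

WHAT IS PROVED (ns `…Theorems.Prop7HcoWOfSigmaRowsDiv`): `joint_arith` (the real-number knit), ★★★ `hcoW_of_sigmaRowsW_slots_div` (the door; conclusion = `hcoW` VERBATIM).
HONEST SCOPE.  Composition + real arithmetic over landed theorems; every analytic row is DISPLAYED; nothing of print is asserted.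

References: T. Bałaban, CMP 102 (1985) 277–309 [Balaban1985Variational] ((47) p.286, (106)–(111) p.294, (138)–(143) pp.298–299, Prop. 7 p.299); CMP 99 (1985) 389–434
[Balaban1985BackgroundPropagators] ((3.10)–(3.12) p.392, Thm 3.11 p.416); CMP 99 (1985) 75–102 [Balaban1985RegularSpaces] ((1.38) p.82, Thm 2 p.83).
-/

set_option autoImplicit false
noncomputable section

open scoped BigOperators Matrix.Norms.L2Operator Matrix Topology InnerProductSpace
open Filter NormedSpace

namespace Summit.QuantumFields.YangMills.Theorems.Prop7HcoWOfSigmaRowsDiv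

open Literature.MathematicalPhysics.QuantumFieldTheory.Balaban1983to89
open Literature.MathematicalPhysics.QuantumFieldTheory.Balaban1983to89.T3ContinuumYM3Torus
open Literature.MathematicalPhysics.QuantumFieldTheory.Balaban1983to89.T3UnitLawDensityEML (ℰp)
open Literature.MathematicalPhysics.QuantumFieldTheory.Balaban1983to89.T3ConstrainedMinimiser (fibre)
open Literature.MathematicalPhysics.QuantumFieldTheory.Balaban1983to89.T3PrintedRegularMinimiser
open Literature.MathematicalPhysics.QuantumFieldTheory.Balaban1983to89.T3RegularMinimiser
open Literature.MathematicalPhysics.QuantumFieldTheory.Balaban1983to89.T3Thm1Carrier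
open T4Continuum BlockAveraging AveragingRT ExpMeanLog BlockAveragingEMLLinearised BlockAveragingEMLLinearisedBackground BlockAveragingEMLProp2
open B10Eq27TorusAxialLog (pull)
open T3SectALandauChart (emb15 eta bgUnits)
open B11Eq103H1Complex (BondL2K)
open Summit.QuantumFields.YangMills.Theorems.Prop7SPrint (basePt RestrictedPrint IsLandauPrintS)
open Summit.QuantumFields.YangMills.Theorems.Prop7SectET3Transport (periodsT3)
open Summit.QuantumFields.YangMills.Theorems.Prop7SectET3HilbertLetters (W₂ toL2)
open Summit.QuantumFields.YangMills.Theorems.Prop7SectET3CurvedPropagators (Qk laplaceA)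
open Summit.QuantumFields.YangMills.Theorems.Prop7HcoWOfGaugedRows (hcoW_of_gaugedRowsW)
open Summit.QuantumFields.YangMills.Theorems.Prop7HessOnPrintSlice (hess_of_laplaceA_coercive_of_isLandauPrintS)
open Summit.QuantumFields.YangMills.Theorems.Prop7HcoWOfSigmaRows (hess_arith)


/-! ## The knit arithmetic -/

/-- The knit arithmetic: `C₁ℓ⁻¹M + C₂ℓ(K + dv) ≤ (C₁ + C₂δ₁)ℓ⁻¹M + C₂(1+ζ)ℓK` when `dv ≤ ζK + δ₁ℓ⁻²M`, `0 ≤ C₂`, `0 < ℓ`. [bookkeeping; cite: Balaban1985Variational, (106)-(111) p.294] -/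
theorem joint_arith {ℓ M Kc dv C₁ C₂ ζ δ₁ : ℝ} (hℓ : 0 < ℓ) (hC₂ : 0 ≤ C₂) (hdv : dv ≤ ζ * Kc + δ₁ * (ℓ ^ 2)⁻¹ * M) :
    C₁ * ℓ⁻¹ * M + C₂ * ℓ * (Kc + dv) ≤ (C₁ + C₂ * δ₁) * ℓ⁻¹ * M + C₂ * (1 + ζ) * ℓ * Kc := by
  have h : C₂ * ℓ * dv ≤ C₂ * ℓ * (ζ * Kc + δ₁ * (ℓ ^ 2)⁻¹ * M) := mul_le_mul_of_nonneg_left hdv (mul_nonneg hC₂ hℓ.le)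
  have hne : ℓ ≠ 0 := hℓ.ne'
  have e1 : C₂ * ℓ * (ζ * Kc + δ₁ * (ℓ ^ 2)⁻¹ * M) = C₂ * ζ * ℓ * Kc + C₂ * δ₁ * ℓ⁻¹ * M := by
    field_simp
  rw [e1] at h
  have e2 : C₁ * ℓ⁻¹ * M + C₂ * ℓ * (Kc + dv) = C₁ * ℓ⁻¹ * M + C₂ * ℓ * Kc + C₂ * ℓ * dv := by ring
  rw [e2]
  have e3 : (C₁ + C₂ * δ₁) * ℓ⁻¹ * M + C₂ * (1 + ζ) * ℓ * Kc = C₁ * ℓ⁻¹ * M + C₂ * ℓ * Kc + (C₂ * ζ * ℓ * Kc + C₂ * δ₁ * ℓ⁻¹ * M) := by ring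
  rw [e3]
  linarith

/-! ## The door (F4″) -/

section DoorSlots

variable (c₀ : ℕ → ℝ) [hc₀ : ∀ L : ℕ, Fact (0 < c₀ L)] (aQ : T3Family → ℕ → ℕ → ℝ)
  (Δx : ∀ (F : T3Family) (K : ℕ), GaugeField (F.P K) 0 (Matrix.specialUnitaryGroup (Fin 2) ℂ) → (BondL2K ℂ 3 (periodsT3 F K) (c₀ F.L) W₂ →ₗ[ℂ] BondL2K ℂ 3 (periodsT3 F K) (c₀ F.L) W₂))
  (Rr : ∀ (F : T3Family) (n K : ℕ), GaugeField (F.P K) 0 (Matrix.specialUnitaryGroup (Fin 2) ℂ) → (B11Eq103H1Complex.SiteL2K ℂ 3 (periodsT3 F K) (c₀ F.L) W₂ →ₗ[ℂ] B11Eq103H1Complex.SiteL2K ℂ 3 (periodsT3 F K) (c₀ F.L) W₂))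
  {CW : ∀ (F : T3Family) (n K : ℕ), n ≤ K → Type} [hCW₁ : ∀ F n K (h : n ≤ K), NormedAddCommGroup (CW F n K h)] [hCW₂ : ∀ F n K (h : n ≤ K), InnerProductSpace ℂ (CW F n K h)]
  [hCW₃ : ∀ F n K (h : n ≤ K), FiniteDimensional ℂ (CW F n K h)]
  (Qc : ∀ (F : T3Family) (n K : ℕ) (h : n ≤ K), GaugeField (F.P K) 0 (Matrix.specialUnitaryGroup (Fin 2) ℂ) → (BondL2K ℂ 3 (periodsT3 F K) (c₀ F.L) W₂ →ₗ[ℂ] CW F n K h))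


set_option maxHeartbeats 400000 in
/-- ★★★ **`hcoW` ⇐ THE Σ-ROWS WITH THE JOINT ROW IN P-A2’s BINDER CURRENCY `C₁ℓ⁻¹M + C₂ℓ(K + DIV)` AND P-A4’s CRUDE SLICE ROW `DIV ≤ ζK + δ₁ℓ⁻²M` (F4″, the namer’s JOINT assembler).**
Same slots and rows as ✓`Prop7HcoWOfSigmaRowsSlots.hcoW_of_sigmaRowsW_slots` (COERC ∕ LANDAU-S ∕ NORM ∕ SLOT ∕ QSMALL ∕ `κ`-arithmetic), except that the member books its (JOINT-Σ) row — modulo an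
`𝔰𝔲(2)`-valued coarse site field, VERBATIM letters of ✓`hcoW_of_gaugedRowsW` — against `C₁ℓ⁻¹·M + C₂ℓ·(K + dv)` where `dv` is the member’s covariant-divergence mass (routeR-w3 g7 LOCATE
bc08ddff §1: the chart remainder is second order in `(∇_W X, D*_W X)`, not in the curl alone), and adds the (DIV-SLICE) row `0 ≤ C₂ ∧ dv ≤ ζ·K + δ₁·ℓ⁻²·M` (P-A4: on print’s slice
`R(W)D*_W X = 0` the divergence is a `K`-scale average, [Balaban1985RegularSpaces] (1.38) p.82 class; px12 g5 pen ∕ displayed row `bern_P`, RULING g28-№15); the windows are stated for the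
knitted constants `(C₁, C₂) ↦ (C₁ + C₂δ₁, C₂(1 + ζ))`: `2e·C₂(1+ζ) ≤ ⅛`, `2e(C₁ + C₂δ₁)ℓ⁻² + 15552s² + 216·regThreshold(e) ≤ κ∕8`.  CONCLUSION = `hcoW` VERBATIM.
Proof: `C₂ℓ·dv ≤ C₂ζℓ·K + C₂δ₁ℓ⁻¹·M` (`joint_arith`), then ✓`hcoW_of_sigmaRowsW_slots`. [cite: Balaban1985Variational, (141)-(142) p.299, Prop. 7 p.299, (47) p.286, (106)-(111) p.294;
Balaban1985BackgroundPropagators, Thm 3.11 p.416, (3.10)-(3.12) p.392; Balaban1985RegularSpaces, (1.38) p.82] -/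
theorem hcoW_of_sigmaRowsW_slots_div
    (hSig : ∀ (L : ℕ), 1 < L → ∀ (B₁ : ℝ), 0 < B₁ → ∃ e₇ c₇ : ℝ, 0 < e₇ ∧ 0 < c₇ ∧
      ∀ (F : T3Family), F.L = L → ∀ (n K : ℕ) (hnK : n < K) (e α : ℝ) (V : GaugeField (F.P n) 0 (Matrix.specialUnitaryGroup (Fin 2) ℂ))
        (W U₁ : GaugeField (F.P K) 0 (Matrix.specialUnitaryGroup (Fin 2) ℂ)) (u : GaugeTransf (F.P K) 0 (Matrix.specialUnitaryGroup (Fin 2) ℂ))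
        (A : PBond (F.P K) 0 → Matrix (Fin 2) (Fin 2) ℂ),
        0 < e → e ≤ e₇ → 0 < α → α ≤ c₇ → W ∈ regFibrePr F n K hnK.le e V →
        (∀ γ : ℝ → GaugeField (F.P K) 0 (Matrix.specialUnitaryGroup (Fin 2) ℂ), γ 0 = W → (∀ t, γ t ∈ fibre F ℰp n K hnK.le V) →
          (∀ b, DifferentiableAt ℝ (fun t => ((γ t b : Matrix.specialUnitaryGroup (Fin 2) ℂ) : Matrix (Fin 2) (Fin 2) ℂ)) 0) →
            deriv (fun t => wilsonAction4 (γ t)) 0 = 0) →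
        RestrictedPrint F n K W u → (∀ b : PBond (F.P K) 0, IsSelfAdjoint (A b)) →
        (∀ b : PBond (F.P K) 0, ((U₁ b : Matrix.specialUnitaryGroup (Fin 2) ℂ) : Matrix (Fin 2) (Fin 2) ℂ) = exp (Complex.I • ((eta F n K) • A b))) →
        (∃ (β₀ B₂ : ℝ) (len : B7Prop1Explicit.Site (F.P K).d → ℝ),
          B8Thm2TorusAt.C136T (F.P K).L (K - n) (eta F n K) β₀ B₁ B₂ len α (pull (bgUnits F K W) (basePt F n K)) (pull A (basePt F n K))) →
        B8Eq138LandauZd.IsLandau138 (F.P K).L (K - n) (eta F n K) (Set.univ : Set (B7Prop1Explicit.Site (F.P K).d)) (B8Thm4TorusAt.torusLam (K - n))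
          (pull (bgUnits F K W) (basePt F n K)) (pull A (basePt F n K)) →
        B8Thm2TorusAt.C139T (F.P K).L (K - n) (eta F n K) B₁ α (pull (bgUnits F K W) (basePt F n K)) (pull A (basePt F n K)) →
        GaugeField.gaugeAct u (emb15 W U₁) ∈ regFibrePr F n K hnK.le e V →
          ∃ s γ cN cK cE qK qM C₁ C₂ κ ζ δ₁ dv : ℝ, (∀ b : PBond (F.P K) 0, ‖(eta F n K • A) b‖ ≤ s) ∧ 4 * s ≤ 1 ∧
            -- (COERC) the QUANTITATIVE coercivity of print's `Δ_a(W) = Δx(W) + D R_S D* + Q_k* a Q_k` on the member's weighted `L²` space ([B9] Thm 3.11 class; N06, RULING g28-№13 (c1)–(c4))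
            (∀ y : BondL2K ℂ 3 (periodsT3 F K) (c₀ F.L) W₂, γ * ‖y‖ ^ 2 ≤ RCLike.re ⟪y, B11Eq103H1Complex.laplaceAK (Δx F K W) (Prop7SectET3HilbertLetters.DL2 F n K (c₀ F.L) W) (Rr F n K W) (Prop7SectET3HilbertLetters.DstarL2 F n K (c₀ F.L) W) (Qc F n K hnK.le W) (LinearMap.adjoint (Qc F n K hnK.le W)) (((aQ F n K : ℝ) : ℂ)) y⟫_ℂ) ∧ 0 ≤ γ ∧
            -- (LANDAU-S) the representative sits on print's slice, read with the symmetric-tube projector `R_S` (the S twin of the hypothesis `IsLandau138`)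
            Rr F n K W (Prop7SectET3HilbertLetters.DstarL2 F n K (c₀ F.L) W (toL2 F K (c₀ F.L) (eta F n K • A))) = 0 ∧
            -- (NORM) the weighted `L²` norm dominates the chart mass
            cN * (∑ b : PBond (F.P K) 0, ‖(eta F n K • A) b‖ ^ 2) ≤ ‖toL2 F K (c₀ F.L) (eta F n K • A)‖ ^ 2 ∧
            -- (SLOT) the Hessian letter is bounded above by the curl form plus an `O(e)` mass term ((3.10): `Δ = D*D + Δ′`)
            RCLike.re ⟪toL2 F K (c₀ F.L) (eta F n K • A), (Δx F K) W (toL2 F K (c₀ F.L) (eta F n K • A))⟫_ℂ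
              ≤ cK * (∑ p : Plaq (F.P K) 0, ‖((Complex.I • (eta F n K • A) ⟨p.src, p.μ⟩) + ((W ⟨p.src, p.μ⟩ : Matrix (Fin 2) (Fin 2) ℂ) * (Complex.I • (eta F n K • A) ⟨p.src.shift p.μ, p.ν⟩) * star (W ⟨p.src, p.μ⟩ : Matrix (Fin 2) (Fin 2) ℂ))
            - (((W ⟨p.src, p.μ⟩ * W ⟨p.src.shift p.μ, p.ν⟩ * (W ⟨p.src.shift p.ν, p.μ⟩)⁻¹ : Matrix.specialUnitaryGroup (Fin 2) ℂ) : Matrix (Fin 2) (Fin 2) ℂ) * (Complex.I • (eta F n K • A) ⟨p.src.shift p.ν, p.μ⟩) * star ((W ⟨p.src, p.μ⟩ * W ⟨p.src.shift p.μ, p.ν⟩ * (W ⟨p.src.shift p.ν, p.μ⟩)⁻¹ : Matrix.specialUnitaryGroup (Fin 2) ℂ) : Matrix (Fin 2) (Fin 2) ℂ))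
            - (((GaugeField.plaqHol W p : Matrix.specialUnitaryGroup (Fin 2) ℂ) : Matrix (Fin 2) (Fin 2) ℂ) * (Complex.I • (eta F n K • A) ⟨p.src, p.ν⟩) * star ((GaugeField.plaqHol W p : Matrix.specialUnitaryGroup (Fin 2) ℂ) : Matrix (Fin 2) (Fin 2) ℂ)))‖ ^ 2)
                + cE * e * (((F.L : ℝ) ^ (K - n)) ^ 2)⁻¹ * (∑ b : PBond (F.P K) 0, ‖(eta F n K • A) b‖ ^ 2) ∧
            -- (QSMALL) the averaging penalty at the representative is small (on Σ it is fourth order)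
            aQ F n K * ‖Qc F n K hnK.le W (toL2 F K (c₀ F.L) (eta F n K • A))‖ ^ 2
              ≤ qK * (∑ p : Plaq (F.P K) 0, ‖((Complex.I • (eta F n K • A) ⟨p.src, p.μ⟩) + ((W ⟨p.src, p.μ⟩ : Matrix (Fin 2) (Fin 2) ℂ) * (Complex.I • (eta F n K • A) ⟨p.src.shift p.μ, p.ν⟩) * star (W ⟨p.src, p.μ⟩ : Matrix (Fin 2) (Fin 2) ℂ))
            - (((W ⟨p.src, p.μ⟩ * W ⟨p.src.shift p.μ, p.ν⟩ * (W ⟨p.src.shift p.ν, p.μ⟩)⁻¹ : Matrix.specialUnitaryGroup (Fin 2) ℂ) : Matrix (Fin 2) (Fin 2) ℂ) * (Complex.I • (eta F n K • A) ⟨p.src.shift p.ν, p.μ⟩) * star ((W ⟨p.src, p.μ⟩ * W ⟨p.src.shift p.μ, p.ν⟩ * (W ⟨p.src.shift p.ν, p.μ⟩)⁻¹ : Matrix.specialUnitaryGroup (Fin 2) ℂ) : Matrix (Fin 2) (Fin 2) ℂ))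
            - (((GaugeField.plaqHol W p : Matrix.specialUnitaryGroup (Fin 2) ℂ) : Matrix (Fin 2) (Fin 2) ℂ) * (Complex.I • (eta F n K • A) ⟨p.src, p.ν⟩) * star ((GaugeField.plaqHol W p : Matrix.specialUnitaryGroup (Fin 2) ℂ) : Matrix (Fin 2) (Fin 2) ℂ)))‖ ^ 2)
                + qM * (((F.L : ℝ) ^ (K - n)) ^ 2)⁻¹ * (∑ b : PBond (F.P K) 0, ‖(eta F n K • A) b‖ ^ 2) ∧
            -- the HESS constant `κ` these rows deliver
            0 < cK + qK ∧ κ * (cK + qK) ≤ γ * cN - (cE * e + qM) * (((F.L : ℝ) ^ (K - n)) ^ 2)⁻¹ ∧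
            (∀ (Q : (k : ℕ) → (PBond (F.P K) 0 → Matrix (Fin 2) (Fin 2) ℂ) → PBond (F.P K) k → Matrix (Fin 2) (Fin 2) ℂ), (∀ Y, Q 0 Y = Y) →
        (∀ (k : ℕ) (Y : PBond (F.P K) 0 → Matrix (Fin 2) (Fin 2) ℂ) (c : PBond (F.P K) (k + 1)), Q (k + 1) Y c
          = fderiv ℂ (eml : (Idx (F.P K) → Matrix (Fin 2) (Fin 2) ℂ) → Matrix (Fin 2) (Fin 2) ℂ)
              (fun i => ((loopHol (Averaging.iter (fun i => blockAvg (P := F.P K) (j := i) (expMeanLogSU (n := Fin 2))) k W) c i :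
                Matrix.specialUnitaryGroup (Fin 2) ℂ) : Matrix (Fin 2) (Fin 2) ℂ))
              (fun i => covWalkSum (Averaging.iter (fun i => blockAvg (P := F.P K) (j := i) (expMeanLogSU (n := Fin 2))) k W) (Q k Y)
                  (walk (emb c.src) (loopWord (F.P K).L c.dir (off i.1) i.2.1 i.2.2))
                * ((loopHol (Averaging.iter (fun i => blockAvg (P := F.P K) (j := i) (expMeanLogSU (n := Fin 2))) k W) c i :
                  Matrix.specialUnitaryGroup (Fin 2) ℂ) : Matrix (Fin 2) (Fin 2) ℂ))
              * star ((corr (expMeanLogSU (n := Fin 2)) (Averaging.iter (fun i => blockAvg (P := F.P K) (j := i) (expMeanLogSU (n := Fin 2))) k W) c :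
                  Matrix.specialUnitaryGroup (Fin 2) ℂ) : Matrix (Fin 2) (Fin 2) ℂ)
            + ((corr (expMeanLogSU (n := Fin 2)) (Averaging.iter (fun i => blockAvg (P := F.P K) (j := i) (expMeanLogSU (n := Fin 2))) k W) c :
                  Matrix.specialUnitaryGroup (Fin 2) ℂ) : Matrix (Fin 2) (Fin 2) ℂ)
              * covWalkSum (Averaging.iter (fun i => blockAvg (P := F.P K) (j := i) (expMeanLogSU (n := Fin 2))) k W) (Q k Y)
                  (walk (emb c.src) (List.replicate (F.P K).L (c.dir, true)))
              * star ((corr (expMeanLogSU (n := Fin 2)) (Averaging.iter (fun i => blockAvg (P := F.P K) (j := i) (expMeanLogSU (n := Fin 2))) k W) c :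
                  Matrix.specialUnitaryGroup (Fin 2) ℂ) : Matrix (Fin 2) (Fin 2) ℂ)) →
            ∃ μ : Site (F.P K) (K - n) → Matrix (Fin 2) (Fin 2) ℂ, (∀ y, μ y ∈ skewAdjoint (Matrix (Fin 2) (Fin 2) ℂ) ∧ (μ y).trace = 0) ∧
            ∑ c : PBond (F.P K) (K - n), ‖Q (K - n) (fun b => Complex.I • (eta F n K • A) b) c
                - (μ c.src
                  - ((Averaging.iter (fun i => blockAvg (P := F.P K) (j := i) (expMeanLogSU (n := Fin 2))) (K - n) W c : Matrix.specialUnitaryGroup (Fin 2) ℂ) :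
                      Matrix (Fin 2) (Fin 2) ℂ) * μ c.tgt
                    * star ((Averaging.iter (fun i => blockAvg (P := F.P K) (j := i) (expMeanLogSU (n := Fin 2))) (K - n) W c : Matrix.specialUnitaryGroup (Fin 2) ℂ) :
                      Matrix (Fin 2) (Fin 2) ℂ))‖
              ≤ C₁ * ((F.L : ℝ) ^ (K - n))⁻¹ * (∑ b : PBond (F.P K) 0, ‖(eta F n K • A) b‖ ^ 2)
                + C₂ * (F.L : ℝ) ^ (K - n) * (∑ p : Plaq (F.P K) 0, ‖((Complex.I • (eta F n K • A) ⟨p.src, p.μ⟩) + ((W ⟨p.src, p.μ⟩ : Matrix (Fin 2) (Fin 2) ℂ) * (Complex.I • (eta F n K • A) ⟨p.src.shift p.μ, p.ν⟩) * star (W ⟨p.src, p.μ⟩ : Matrix (Fin 2) (Fin 2) ℂ))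
            - (((W ⟨p.src, p.μ⟩ * W ⟨p.src.shift p.μ, p.ν⟩ * (W ⟨p.src.shift p.ν, p.μ⟩)⁻¹ : Matrix.specialUnitaryGroup (Fin 2) ℂ) : Matrix (Fin 2) (Fin 2) ℂ) * (Complex.I • (eta F n K • A) ⟨p.src.shift p.ν, p.μ⟩) * star ((W ⟨p.src, p.μ⟩ * W ⟨p.src.shift p.μ, p.ν⟩ * (W ⟨p.src.shift p.ν, p.μ⟩)⁻¹ : Matrix.specialUnitaryGroup (Fin 2) ℂ) : Matrix (Fin 2) (Fin 2) ℂ))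
            - (((GaugeField.plaqHol W p : Matrix.specialUnitaryGroup (Fin 2) ℂ) : Matrix (Fin 2) (Fin 2) ℂ) * (Complex.I • (eta F n K • A) ⟨p.src, p.ν⟩) * star ((GaugeField.plaqHol W p : Matrix.specialUnitaryGroup (Fin 2) ℂ) : Matrix (Fin 2) (Fin 2) ℂ)))‖ ^ 2 + dv)) ∧
            -- (DIV-SLICE) P-A4: on print’s slice the member’s covariant-divergence mass `dv` is booked against the curl form and an `ℓ⁻²`-mass term (crude slice row; [B10] (1.38))
            0 ≤ C₂ ∧ dv ≤ ζ * ∑ p : Plaq (F.P K) 0, ‖((Complex.I • (eta F n K • A) ⟨p.src, p.μ⟩) + ((W ⟨p.src, p.μ⟩ : Matrix (Fin 2) (Fin 2) ℂ) * (Complex.I • (eta F n K • A) ⟨p.src.shift p.μ, p.ν⟩) * star (W ⟨p.src, p.μ⟩ : Matrix (Fin 2) (Fin 2) ℂ))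
            - (((W ⟨p.src, p.μ⟩ * W ⟨p.src.shift p.μ, p.ν⟩ * (W ⟨p.src.shift p.ν, p.μ⟩)⁻¹ : Matrix.specialUnitaryGroup (Fin 2) ℂ) : Matrix (Fin 2) (Fin 2) ℂ) * (Complex.I • (eta F n K • A) ⟨p.src.shift p.ν, p.μ⟩) * star ((W ⟨p.src, p.μ⟩ * W ⟨p.src.shift p.μ, p.ν⟩ * (W ⟨p.src.shift p.ν, p.μ⟩)⁻¹ : Matrix.specialUnitaryGroup (Fin 2) ℂ) : Matrix (Fin 2) (Fin 2) ℂ))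
            - (((GaugeField.plaqHol W p : Matrix.specialUnitaryGroup (Fin 2) ℂ) : Matrix (Fin 2) (Fin 2) ℂ) * (Complex.I • (eta F n K • A) ⟨p.src, p.ν⟩) * star ((GaugeField.plaqHol W p : Matrix.specialUnitaryGroup (Fin 2) ℂ) : Matrix (Fin 2) (Fin 2) ℂ)))‖ ^ 2
                + δ₁ * (((F.L : ℝ) ^ (K - n)) ^ 2)⁻¹ * (∑ b : PBond (F.P K) 0, ‖(eta F n K • A) b‖ ^ 2) ∧
            2 * e * (C₂ * (1 + ζ)) ≤ 1 / 8 ∧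
            2 * e * (C₁ + C₂ * δ₁) * (((F.L : ℝ) ^ (K - n)) ^ 2)⁻¹ + 15552 * s ^ 2 + 216 * regThreshold F n K e ≤ κ / 8) :
    ∀ (L : ℕ), 1 < L → ∀ (B₁ : ℝ), 0 < B₁ → ∃ e₇ c₇ : ℝ, 0 < e₇ ∧ 0 < c₇ ∧
      ∀ (F : T3Family), F.L = L → ∀ (n K : ℕ) (hnK : n < K) (e α : ℝ) (V : GaugeField (F.P n) 0 (Matrix.specialUnitaryGroup (Fin 2) ℂ))
        (W U₁ : GaugeField (F.P K) 0 (Matrix.specialUnitaryGroup (Fin 2) ℂ)) (u : GaugeTransf (F.P K) 0 (Matrix.specialUnitaryGroup (Fin 2) ℂ))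
        (A : PBond (F.P K) 0 → Matrix (Fin 2) (Fin 2) ℂ),
        0 < e → e ≤ e₇ → 0 < α → α ≤ c₇ → W ∈ regFibrePr F n K hnK.le e V →
        (∀ γ : ℝ → GaugeField (F.P K) 0 (Matrix.specialUnitaryGroup (Fin 2) ℂ), γ 0 = W → (∀ t, γ t ∈ fibre F ℰp n K hnK.le V) →
          (∀ b, DifferentiableAt ℝ (fun t => ((γ t b : Matrix.specialUnitaryGroup (Fin 2) ℂ) : Matrix (Fin 2) (Fin 2) ℂ)) 0) →
            deriv (fun t => wilsonAction4 (γ t)) 0 = 0) →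
        RestrictedPrint F n K W u → (∀ b : PBond (F.P K) 0, IsSelfAdjoint (A b)) →
        (∀ b : PBond (F.P K) 0, ((U₁ b : Matrix.specialUnitaryGroup (Fin 2) ℂ) : Matrix (Fin 2) (Fin 2) ℂ) = exp (Complex.I • ((eta F n K) • A b))) →
        (∃ (β₀ B₂ : ℝ) (len : B7Prop1Explicit.Site (F.P K).d → ℝ),
          B8Thm2TorusAt.C136T (F.P K).L (K - n) (eta F n K) β₀ B₁ B₂ len α (pull (bgUnits F K W) (basePt F n K)) (pull A (basePt F n K))) →
        B8Eq138LandauZd.IsLandau138 (F.P K).L (K - n) (eta F n K) (Set.univ : Set (B7Prop1Explicit.Site (F.P K).d)) (B8Thm4TorusAt.torusLam (K - n))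
          (pull (bgUnits F K W) (basePt F n K)) (pull A (basePt F n K)) →
        B8Thm2TorusAt.C139T (F.P K).L (K - n) (eta F n K) B₁ α (pull (bgUnits F K W) (basePt F n K)) (pull A (basePt F n K)) →
        GaugeField.gaugeAct u (emb15 W U₁) ∈ regFibrePr F n K hnK.le e V →
          wilsonAction4 W ≤ wilsonAction4 (emb15 W U₁) := by
  refine Prop7HcoWOfSigmaRowsSlots.hcoW_of_sigmaRowsW_slots c₀ aQ Δx Rr Qc ?_
  intro L hL B₁ hB₁
  obtain ⟨e₇, c₇, he₇, hc₇, H⟩ := hSig L hL B₁ hB₁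
  refine ⟨e₇, c₇, he₇, hc₇, ?_⟩
  intro F hF n K hnK e α V W U₁ u A he heε hα hαc hWreg hEL hRP hA hU₁ h136 h138 h139 hmem
  obtain ⟨s, γ, cN, cK, cE, qK, qM, C₁, C₂, κ, ζ, δ₁, dv, hs, hs4, hco, hγ, hLS, hN, hSl, hQ, hpos, hκ, hJ, hC₂, hdv, hw1, hw2⟩ :=
    H F hF n K hnK e α V W U₁ u A he heε hα hαc hWreg hEL hRP hA hU₁ h136 h138 h139 hmem
  refine ⟨s, γ, cN, cK, cE, qK, qM, C₁ + C₂ * δ₁, C₂ * (1 + ζ), κ, hs, hs4, hco, hγ, hLS, hN, hSl, hQ, hpos, hκ, ?_, hw1, hw2⟩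
  intro Q hQ0 hQs
  obtain ⟨μ, hμ, hb⟩ := hJ Q hQ0 hQs
  refine ⟨μ, hμ, hb.trans ?_⟩
  have hLpos : (0 : ℝ) < (F.L : ℝ) ^ (K - n) := by
    have : (1 : ℝ) < (F.L : ℝ) := by rw [hF]; exact_mod_cast hL
    positivity
  exact joint_arith hLpos hC₂ hdv

end DoorSlots

end Summit.QuantumFields.YangMills.Theorems.Prop7HcoWOfSigmaRowsDiv

end
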